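import Literature.Analysis.FluidPDE.NSBootstrapContinuousRep
import HarnessLib

/-!
# The Serrin bootstrap: smooth slices and Hölder continuous derivatives

Analysis/FluidPDE proofs file (theorems only). The continuous representative `V` of
`NSBootstrap.exists_continuous_rep` has, at every time, smooth slices with all derivatives
bounded, and `w ↦ Dⁿₓ V(w.1, ·)(w.2)` is Hölder continuous on every `Q(0, r)`, `r < R`, with
constants fixed before the solution (`exists_smooth_holder_rep`; Seregin–Šverák 2009, §2 p. 8:
"all derivatives `∇ᵏu` are Hölder continuous … in the closure of `Q(3/4)`"). Good times (those
of `NSBootstrap.ae_smooth_slices`) are dense; at any time the cut-off slices are uniform limits of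
cut-off good slices with uniformly bounded derivatives, hence smooth with the same bounds
(`Calculus.uniformCauchySeqOn_iteratedFDeriv_of_uniformCauchySeqOn`,
`FunctionSpaces.contDiffOn_infty_of_uniformCauchySeqOn_iteratedFDeriv`); Hölder continuity of the
derivatives in time follows from the Hölder modulus of `V` by Landau's interpolation
(`Calculus.norm_iteratedFDeriv_succ_le_of_bounds`), in space from the bound of the next
derivative.

## References

* G. Seregin, V. Šverák, Comm. PDE 34 (2009) = arXiv:0804.1803, §2 p. 8. [`SereginSverak2009`]
* E. Landau, Proc. LMS 13 (1913); J. Dieudonné, *Foundations of Modern Analysis*, (8.6.3). [folklore]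
-/

noncomputable section

open MeasureTheory Set Function Filter Topology TopologicalSpace Metric
open scoped NNReal ENNReal RealInnerProductSpace ContDiff

namespace Literature.Analysis.FluidPDE

namespace NSBootstrap

open RepDeriv SliceTimeHolder Literature.Analysis.FunctionSpaces

/-! ### Cut-offs -/

/-- **A cut-off with bounded derivatives.** For `r₃ < ρ` (`0 < r₃`) there is a smooth
`χ : ℝ³ → [0, 1]`, equal to `1` on `B(0, r₃)`, with `tsupport χ ⊆ B(0, ρ)` and
`‖Dᵏχ‖ ≤ C_k`. [folklore] -/
theorem exists_cutoff {r₃ ρ : ℝ} (hr₃ : 0 < r₃) (hρ : r₃ < ρ) :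
    ∃ (χ : EuclideanSpace ℝ (Fin 3) → ℝ) (C : ℕ → ℝ), ContDiff ℝ ∞ χ ∧ (∀ x ∈ ball (0 : EuclideanSpace ℝ (Fin 3)) r₃, χ x = 1) ∧
      tsupport χ ⊆ ball (0 : EuclideanSpace ℝ (Fin 3)) ρ ∧ (∀ x, |χ x| ≤ 1) ∧
      ∀ (k : ℕ) (x : EuclideanSpace ℝ (Fin 3)), ‖iteratedFDeriv ℝ k χ x‖ ≤ C k := by
  set φ : ContDiffBump (0 : EuclideanSpace ℝ (Fin 3)) := ⟨r₃, (r₃ + ρ) / 2, hr₃, by linarith⟩ with hφ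
  have hs : ContDiff ℝ ∞ φ := φ.contDiff
  have hb : ∀ k : ℕ, ∃ C, ∀ x, ‖iteratedFDeriv ℝ k φ x‖ ≤ C := fun k =>
    (hs.continuous_iteratedFDeriv (by exact_mod_cast le_top)).bounded_above_of_compact_support
      (φ.hasCompactSupport.iteratedFDeriv k)
  choose C hC using hb
  refine ⟨φ, C, hs, fun x hx => φ.one_of_mem_closedBall (ball_subset_closedBall hx), ?_, fun x => ?_, hC⟩
  · rw [φ.tsupport_eq]
    exact closedBall_subset_ball (by show (r₃ + ρ) / 2 < ρ; linarith)
  · rw [abs_of_nonneg φ.nonneg]; exact φ.le_one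

/-- **Cutting off a function smooth on a ball.** If `χ` is smooth with `tsupport χ ⊆ B(0, ρ)` and
`f` is smooth on `B(0, ρ)`, then `χ f` is smooth on `ℝ³`; its derivatives are bounded through
the Leibniz rule by bounds of the derivatives of `χ` everywhere and of `f` on the ball; and
`χ f = f` near every point where `χ = 1` nearby. [folklore] -/
theorem cutoff_mul {ρ : ℝ} {χ f : EuclideanSpace ℝ (Fin 3) → ℝ} (hχ : ContDiff ℝ ∞ χ)
    (hχs : tsupport χ ⊆ ball (0 : EuclideanSpace ℝ (Fin 3)) ρ) {C B : ℕ → ℝ}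
    (hC : ∀ (k : ℕ) (x : EuclideanSpace ℝ (Fin 3)), ‖iteratedFDeriv ℝ k χ x‖ ≤ C k)
    (hf : ContDiffOn ℝ ∞ f (ball (0 : EuclideanSpace ℝ (Fin 3)) ρ))
    (hB : ∀ (k : ℕ), ∀ x ∈ ball (0 : EuclideanSpace ℝ (Fin 3)) ρ, ‖iteratedFDeriv ℝ k f x‖ ≤ B k)
    (hB0 : ∀ k, 0 ≤ B k) (hC0 : ∀ k, 0 ≤ C k) :
    ContDiff ℝ ∞ (fun x => χ x * f x) ∧
      ∀ (k : ℕ) (x : EuclideanSpace ℝ (Fin 3)), ‖iteratedFDeriv ℝ k (fun x => χ x * f x) x‖ ≤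
        ∑ i ∈ Finset.range (k + 1), (k.choose i : ℝ) * C i * B (k - i) := by
  have hopen : IsOpen (ball (0 : EuclideanSpace ℝ (Fin 3)) ρ) := isOpen_ball
  -- outside the support the product vanishes near the point
  have hzero : ∀ x ∉ ball (0 : EuclideanSpace ℝ (Fin 3)) ρ, (fun y => χ y * f y) =ᶠ[𝓝 x] fun _ => 0 := by
    intro x hx
    have hx' : x ∉ tsupport χ := fun h => hx (hχs h)
    have hn : (tsupport χ)ᶜ ∈ 𝓝 x := (isClosed_tsupport χ).isOpen_compl.mem_nhds hx'
    filter_upwards [hn] with y hy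
    rw [image_eq_zero_of_notMem_tsupport hy, zero_mul]
  have hsmooth : ContDiff ℝ ∞ (fun x => χ x * f x) := by
    refine contDiff_iff_contDiffAt.2 fun x => ?_
    by_cases hx : x ∈ ball (0 : EuclideanSpace ℝ (Fin 3)) ρ
    · exact hχ.contDiffAt.mul (hf.contDiffAt (hopen.mem_nhds hx))
    · exact (contDiffAt_const (c := (0 : ℝ))).congr_of_eventuallyEq (hzero x hx)
  refine ⟨hsmooth, fun k x => ?_⟩
  have hsum0 : 0 ≤ ∑ i ∈ Finset.range (k + 1), (k.choose i : ℝ) * C i * B (k - i) :=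
    Finset.sum_nonneg fun i _ => mul_nonneg (mul_nonneg (Nat.cast_nonneg _) (hC0 i)) (hB0 _)
  by_cases hx : x ∈ ball (0 : EuclideanSpace ℝ (Fin 3)) ρ
  · -- Leibniz on the open ball, where within = everywhere
    have huniq : UniqueDiffOn ℝ (ball (0 : EuclideanSpace ℝ (Fin 3)) ρ) := hopen.uniqueDiffOn
    have h := norm_iteratedFDerivWithin_mul_le (𝕜 := ℝ) (N := ∞) hχ.contDiffOn hf huniq hx (n := k)
      (by exact_mod_cast le_top)
    rw [iteratedFDerivWithin_of_isOpen k hopen hx] at h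
    refine h.trans (Finset.sum_le_sum fun i hi => ?_)
    rw [iteratedFDerivWithin_of_isOpen i hopen hx, iteratedFDerivWithin_of_isOpen (k - i) hopen hx, mul_assoc, mul_assoc]
    refine mul_le_mul_of_nonneg_left ?_ (Nat.cast_nonneg _)
    exact mul_le_mul (hC i x) (hB (k - i) x hx) (norm_nonneg _) (hC0 i)
  · have h0 : iteratedFDeriv ℝ k (fun y => χ y * f y) x = 0 := by
      rw [((hzero x hx).iteratedFDeriv ℝ k).eq_of_nhds, iteratedFDeriv_fun_zero]
      rfl
    rw [h0, norm_zero]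
    exact hsum0

/-! ### Landau's interpolation: small functions with bounded derivatives have small derivatives -/

/-- **Landau in all orders.** If `f` is smooth on `ℝ³` with `‖Dᵏf‖ ≤ B_k` everywhere and
`‖f‖ ≤ ε ≤ 1`, then `‖Dᵏf‖ ≤ c_k ε^{2^{-k}}` with `c₀ = 1`, `c_{k+1} = 2c_k + B_{k+2}`
(Landau 1913; Dieudonné (8.6.3); by `Calculus.norm_iteratedFDeriv_succ_le_of_bounds` with the
step `s = ε^{2^{-(k+1)}}`). [folklore] -/
theorem norm_iteratedFDeriv_le_of_small {G : Type*} [NormedAddCommGroup G] [NormedSpace ℝ G]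
    {f : EuclideanSpace ℝ (Fin 3) → G} (hf : ContDiff ℝ ∞ f) {B : ℕ → ℝ} (hB0 : ∀ k, 0 ≤ B k)
    (hB : ∀ (k : ℕ) (y : EuclideanSpace ℝ (Fin 3)), ‖iteratedFDeriv ℝ k f y‖ ≤ B k) {ε : ℝ} (hε0 : 0 ≤ ε) (hε1 : ε ≤ 1)
    (h0 : ∀ y, ‖f y‖ ≤ ε) :
    ∀ (k : ℕ) (y : EuclideanSpace ℝ (Fin 3)),
      ‖iteratedFDeriv ℝ k f y‖ ≤ (Nat.rec 1 (fun k c => 2 * c + B (k + 2)) k : ℝ) * ε ^ ((1 / 2 : ℝ) ^ k) := by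
  -- the coefficients are nonnegative
  have hc0 : ∀ k : ℕ, (0 : ℝ) ≤ Nat.rec 1 (fun k c => 2 * c + B (k + 2)) k := by
    intro k; induction k with
    | zero => exact zero_le_one
    | succ k ih => exact add_nonneg (mul_nonneg two_pos.le ih) (hB0 _)
  rcases hε0.eq_or_lt with rfl | hεpos
  · -- `ε = 0`: the function vanishes
    intro k y
    have hf0 : f = fun _ => 0 := funext fun y => norm_le_zero_iff.1 (h0 y)
    rcases Nat.eq_zero_or_pos k with rfl | hk
    · simp only [pow_zero, Real.rpow_one]
      simpa using h0 y
    · rw [hf0, iteratedFDeriv_fun_zero]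
      simp only [Pi.zero_apply, norm_zero]
      exact mul_nonneg (hc0 k) (Real.rpow_nonneg le_rfl _)
  intro k
  induction k with
  | zero =>
    intro y
    simp only [pow_zero, Real.rpow_one]
    simpa using h0 y
  | succ k ih =>
    intro y
    set a : ℝ := (1 / 2 : ℝ) ^ k with ha
    have ha1 : (1 / 2 : ℝ) ^ (k + 1) = a / 2 := by rw [pow_succ, ha]; ring
    set s : ℝ := ε ^ (a / 2) with hs
    have hs0 : 0 < s := Real.rpow_pos_of_pos hεpos _
    have hs1 : s ≤ 1 := Real.rpow_le_one hε0 hε1 (by positivity)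
    have h := Calculus.norm_iteratedFDeriv_succ_le_of_bounds hf (p := y) (r := 2) (hB0 (k + 2)) (k := k)
      (fun z _ => ih z) (fun z _ => hB (k + 2) z) hs0 (by linarith)
    refine h.trans ?_
    rw [ha1]
    show 2 * ((Nat.rec 1 (fun k c => 2 * c + B (k + 2)) k : ℝ) * ε ^ a) / s + s * B (k + 2) ≤
      (2 * (Nat.rec 1 (fun k c => 2 * c + B (k + 2)) k : ℝ) + B (k + 2)) * ε ^ (a / 2)
    have hsplit : ε ^ a = s * s := by
      rw [hs, ← Real.rpow_add hεpos]; congr 1; ring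
    rw [hsplit, show 2 * ((Nat.rec 1 (fun k c => 2 * c + B (k + 2)) k : ℝ) * (s * s)) / s =
      2 * (Nat.rec 1 (fun k c => 2 * c + B (k + 2)) k : ℝ) * s by field_simp]
    nlinarith [hc0 k, hB0 (k + 2)]


/-! ### Smooth cut-off slices at every time -/

/-- A set of full measure in an open interval is dense in it: points of the interval are limits
of sequences in the set. [folklore] -/
theorem exists_seq_tendsto_of_ae_Ioo {a b : ℝ} {G : Set ℝ} (hG : ∀ᵐ t ∂(volume.restrict (Ioo a b)), t ∈ G)
    {t₀ : ℝ} (ht₀ : t₀ ∈ Ioo a b) :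
    ∃ ts : ℕ → ℝ, (∀ m, ts m ∈ G ∧ ts m ∈ Ioo a b) ∧ Tendsto ts atTop (𝓝 t₀) := by
  have hcl : t₀ ∈ closure (G ∩ Ioo a b) := by
    rw [Metric.mem_closure_iff]
    intro ε hε
    by_contra h
    have h' : ∀ t ∈ G ∩ Ioo a b, ε ≤ dist t₀ t := fun t ht => by
      by_contra hlt
      exact h ⟨t, ht, lt_of_not_ge hlt⟩
    have hsub : ball t₀ ε ∩ Ioo a b ⊆ {t | ¬ (t ∈ Ioo a b → t ∈ G)} := by
      intro t ht himp
      exact (h' t ⟨himp ht.2, ht.2⟩).not_gt (by rw [dist_comm]; exact mem_ball.1 ht.1)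
    have hpos : 0 < volume (ball t₀ ε ∩ Ioo a b) :=
      (isOpen_ball.inter isOpen_Ioo).measure_pos volume ⟨t₀, mem_ball_self hε, ht₀⟩
    have hzero : volume {t | ¬ (t ∈ Ioo a b → t ∈ G)} = 0 :=
      ae_iff.1 ((ae_restrict_iff' measurableSet_Ioo).1 hG)
    exact (lt_of_lt_of_le hpos ((measure_mono hsub).trans hzero.le)).ne rfl
  obtain ⟨ts, hts, hlim⟩ := mem_closure_iff_seq_limit.1 hcl
  exact ⟨ts, fun m => hts m, hlim⟩

set_option maxHeartbeats 6400000 in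
/-- **Smooth cut-off slices at every time, with bounds.** Let `V` be continuous on `C(r₁², r₁)`
with `HolderOnWith K₀ κ₀ V` there (`κ₀ > 0`), let `r₃ < r₂ < r₁`, and suppose that for a.e.
`t ∈ ]-r₂², 0[` every component slice `V_b(t, ·)` agrees a.e. on `B(0, r₂)` with a smooth function
whose derivatives are bounded by `3ᵏ K_k`. Let `χ` be a cut-off (`tsupport χ ⊆ B(0, r₂)`,
`|χ| ≤ 1`, `‖Dᵏχ‖ ≤ C_k`). Then for **every** `t ∈ ]-r₂², 0[` and every `b` the function
`χ V_b(t, ·)` is smooth on `ℝ³` with `‖Dᵏ(χ V_b(t, ·))‖ ≤ Σᵢ (k choose i) Cᵢ 3^{k-i} K_{k-i}`: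
good times by the Leibniz rule, all times as uniform limits of good times
(`Calculus.uniformCauchySeqOn_iteratedFDeriv_of_uniformCauchySeqOn`,
`FunctionSpaces.contDiffOn_infty_of_uniformCauchySeqOn_iteratedFDeriv`). [folklore] -/
theorem smooth_cutoff_slices {r₁ r₂ : ℝ} (hr₂ : 0 < r₂) (hr₂₁ : r₂ < r₁)
    {V : ℝ × EuclideanSpace ℝ (Fin 3) → EuclideanSpace ℝ (Fin 3)} (hVc : ContinuousOn V (cyl (r₁ ^ 2) r₁))
    {K₀ κ₀ : ℝ≥0} (hκ₀ : 0 < κ₀) (hVH : HolderOnWith K₀ κ₀ V (cyl (r₁ ^ 2) r₁)) {Ks : ℕ → ℝ≥0}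
    (hgood : ∀ᵐ t ∂(volume.restrict (Ioo (-r₂ ^ 2) 0)), ∀ b : Fin 3, ∃ v : EuclideanSpace ℝ (Fin 3) → ℝ,
      (fun x => V (t, x) b) =ᵐ[volume.restrict (ball (0 : EuclideanSpace ℝ (Fin 3)) r₂)] v ∧
      ContDiffOn ℝ ∞ v (ball (0 : EuclideanSpace ℝ (Fin 3)) r₂) ∧
      ∀ k : ℕ, ∀ x ∈ ball (0 : EuclideanSpace ℝ (Fin 3)) r₂, ‖iteratedFDeriv ℝ k v x‖ ≤ 3 ^ k * Ks k)
    {χ : EuclideanSpace ℝ (Fin 3) → ℝ} {C : ℕ → ℝ} (hχ : ContDiff ℝ ∞ χ)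
    (hχs : tsupport χ ⊆ ball (0 : EuclideanSpace ℝ (Fin 3)) r₂) (hχ1 : ∀ x, |χ x| ≤ 1)
    (hC : ∀ (k : ℕ) (x : EuclideanSpace ℝ (Fin 3)), ‖iteratedFDeriv ℝ k χ x‖ ≤ C k) (hC0 : ∀ k, 0 ≤ C k) :
    ∀ t ∈ Ioo (-r₂ ^ 2) 0, ∀ b : Fin 3, ContDiff ℝ ∞ (fun x => χ x * V (t, x) b) ∧
      ∀ (k : ℕ) (x : EuclideanSpace ℝ (Fin 3)), ‖iteratedFDeriv ℝ k (fun x => χ x * V (t, x) b) x‖ ≤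
        ∑ i ∈ Finset.range (k + 1), (k.choose i : ℝ) * C i * (3 ^ (k - i) * Ks (k - i)) := by
  set B : ℕ → ℝ := fun k => 3 ^ k * Ks k with hBdef
  have hB0 : ∀ k, 0 ≤ B k := fun k => by positivity
  set PB : ℕ → ℝ := fun k => ∑ i ∈ Finset.range (k + 1), (k.choose i : ℝ) * C i * B (k - i) with hPB
  set I : Set ℝ := Ioo (-r₂ ^ 2) 0 with hI
  set Bρ : Set (EuclideanSpace ℝ (Fin 3)) := ball 0 r₂ with hBρ
  have hsubc : I ×ˢ Bρ ⊆ cyl (r₁ ^ 2) r₁ :=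
    Set.prod_mono (Ioo_subset_Ioo (by nlinarith) le_rfl) (ball_subset_ball hr₂₁.le)
  -- components are controlled by the vector
  have hcomp : ∀ (z z' : EuclideanSpace ℝ (Fin 3)) (b : Fin 3), ‖z b - z' b‖ ≤ ‖z - z'‖ := fun z z' b => by
    have h := PiLp.norm_apply_le (p := 2) (z - z') b
    simpa using h
  -- Step 1: good times
  have hstep1 : ∀ t ∈ I, (∀ b : Fin 3, ∃ v : EuclideanSpace ℝ (Fin 3) → ℝ,
      (fun x => V (t, x) b) =ᵐ[volume.restrict Bρ] v ∧ ContDiffOn ℝ ∞ v Bρ ∧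
      ∀ k : ℕ, ∀ x ∈ Bρ, ‖iteratedFDeriv ℝ k v x‖ ≤ 3 ^ k * Ks k) →
      ∀ b : Fin 3, ContDiff ℝ ∞ (fun x => χ x * V (t, x) b) ∧
        ∀ (k : ℕ) (x : EuclideanSpace ℝ (Fin 3)), ‖iteratedFDeriv ℝ k (fun x => χ x * V (t, x) b) x‖ ≤ PB k := by
    intro t ht hv b
    obtain ⟨v, hae, hvs, hvb⟩ := hv b
    -- the slice is continuous on the ball, hence equal to `v` there
    have hslc : ContinuousOn (fun x => V (t, x) b) Bρ := by
      have h1 : ContinuousOn (fun x : EuclideanSpace ℝ (Fin 3) => V (t, x)) Bρ :=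
        hVc.comp (continuousOn_const.prodMk continuousOn_id) fun x hx => hsubc (mk_mem_prod ht hx)
      exact (EuclideanSpace.proj b : EuclideanSpace ℝ (Fin 3) →L[ℝ] ℝ).continuous.comp_continuousOn h1
    have hvc : ContinuousOn v Bρ := hvs.continuousOn
    have heq : EqOn (fun x => V (t, x) b) v Bρ := Measure.eqOn_open_of_ae_eq hae isOpen_ball hslc hvc
    have hfs : ContDiffOn ℝ ∞ (fun x => V (t, x) b) Bρ := hvs.congr heq
    have hfb : ∀ k : ℕ, ∀ x ∈ Bρ, ‖iteratedFDeriv ℝ k (fun x => V (t, x) b) x‖ ≤ B k := by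
      intro k x hx
      have hev : (fun x => V (t, x) b) =ᶠ[𝓝 x] v := by
        filter_upwards [isOpen_ball.mem_nhds hx] with y hy using heq hy
      rw [(hev.iteratedFDeriv ℝ k).eq_of_nhds]
      exact hvb k x hx
    exact cutoff_mul hχ hχs hC hfs hfb hB0 hC0
  -- Step 2: all times
  intro t₀ ht₀ b
  have hG : ∀ᵐ t ∂(volume.restrict I), t ∈ {t | ∀ b : Fin 3, ∃ v : EuclideanSpace ℝ (Fin 3) → ℝ,
      (fun x => V (t, x) b) =ᵐ[volume.restrict Bρ] v ∧ ContDiffOn ℝ ∞ v Bρ ∧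
      ∀ k : ℕ, ∀ x ∈ Bρ, ‖iteratedFDeriv ℝ k v x‖ ≤ 3 ^ k * Ks k} := hgood
  obtain ⟨ts, hts, hlim⟩ := exists_seq_tendsto_of_ae_Ioo hG ht₀
  set f : ℕ → EuclideanSpace ℝ (Fin 3) → ℝ := fun m x => χ x * V (ts m, x) b with hf
  set f₀ : EuclideanSpace ℝ (Fin 3) → ℝ := fun x => χ x * V (t₀, x) b with hf₀
  have hfm : ∀ m, ContDiff ℝ ∞ (f m) ∧ ∀ (k : ℕ) (x : EuclideanSpace ℝ (Fin 3)), ‖iteratedFDeriv ℝ k (f m) x‖ ≤ PB k :=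
    fun m => hstep1 (ts m) (hts m).2 (hts m).1 b
  -- the modulus in time, uniformly in space
  have hmod : ∀ t ∈ I, ∀ s ∈ I, ∀ x, ‖χ x * V (t, x) b - χ x * V (s, x) b‖ ≤ K₀ * |t - s| ^ (κ₀ : ℝ) := by
    intro t ht s hs x
    by_cases hx : x ∈ Bρ
    · have h1 : ‖V (t, x) - V (s, x)‖ ≤ K₀ * |t - s| ^ (κ₀ : ℝ) := by
        have h := hVH.dist_le (hsubc (mk_mem_prod ht hx)) (hsubc (mk_mem_prod hs hx))
        have hd : dist (t, x) (s, x) = |t - s| := by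
          rw [Prod.dist_eq, dist_self, Real.dist_eq]
          exact max_eq_left (abs_nonneg _)
        rw [dist_eq_norm, hd] at h
        exact h
      rw [← mul_sub, norm_mul, Real.norm_eq_abs]
      calc |χ x| * ‖V (t, x) b - V (s, x) b‖ ≤ 1 * ‖V (t, x) - V (s, x)‖ :=
            mul_le_mul (hχ1 x) (hcomp _ _ b) (norm_nonneg _) zero_le_one
        _ ≤ K₀ * |t - s| ^ (κ₀ : ℝ) := by rw [one_mul]; exact h1
    · have hx0 : χ x = 0 := image_eq_zero_of_notMem_tsupport fun h => hx (hχs h)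
      simp only [hx0, zero_mul, sub_self, norm_zero]
      positivity
  have htend0 : Tendsto (fun m => (K₀ : ℝ) * |ts m - t₀| ^ (κ₀ : ℝ)) atTop (𝓝 0) := by
    have h1 : Tendsto (fun m => |ts m - t₀|) atTop (𝓝 0) := by
      have := (hlim.sub_const t₀).abs
      rwa [sub_self, abs_zero] at this
    have h2 : Tendsto (fun m => |ts m - t₀| ^ (κ₀ : ℝ)) atTop (𝓝 0) := by
      have := h1.rpow_const (p := (κ₀ : ℝ)) (Or.inr κ₀.coe_nonneg)
      rwa [Real.zero_rpow (by exact_mod_cast hκ₀.ne')] at this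
    simpa using h2.const_mul (K₀ : ℝ)
  -- pointwise convergence everywhere
  have hpt : ∀ x, Tendsto (fun m => f m x) atTop (𝓝 (f₀ x)) := by
    intro x
    rw [tendsto_iff_norm_sub_tendsto_zero]
    refine squeeze_zero (fun m => norm_nonneg _) (fun m => hmod (ts m) (hts m).2 t₀ ht₀ x) htend0
  -- uniformly Cauchy everywhere
  have hUC : ∀ S : Set (EuclideanSpace ℝ (Fin 3)), UniformCauchySeqOn f atTop S := by
    intro S
    rw [Metric.uniformCauchySeqOn_iff]
    intro ε hε
    have hev := (htend0.eventually (gt_mem_nhds (half_pos hε)))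
    rw [eventually_atTop] at hev
    obtain ⟨N, hN⟩ := hev
    refine ⟨N, fun m hm n hn x _ => ?_⟩
    rw [dist_eq_norm]
    calc ‖f m x - f n x‖ = ‖(f m x - f₀ x) - (f n x - f₀ x)‖ := by congr 1; ring
      _ ≤ ‖f m x - f₀ x‖ + ‖f n x - f₀ x‖ := norm_sub_le _ _
      _ ≤ K₀ * |ts m - t₀| ^ (κ₀ : ℝ) + K₀ * |ts n - t₀| ^ (κ₀ : ℝ) :=
          add_le_add (hmod (ts m) (hts m).2 t₀ ht₀ x) (hmod (ts n) (hts n).2 t₀ ht₀ x)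
      _ < ε / 2 + ε / 2 := add_lt_add (hN m hm) (hN n hn)
      _ = ε := by ring
  -- derivatives are uniformly Cauchy near every point
  have hderC : ∀ (i : ℕ) (x : EuclideanSpace ℝ (Fin 3)), x ∈ (univ : Set (EuclideanSpace ℝ (Fin 3))) →
      ∃ W ∈ 𝓝 x, UniformCauchySeqOn (fun j => iteratedFDeriv ℝ i (f j)) atTop W := by
    intro i x _
    refine ⟨ball x (1 / 2 ^ i), isOpen_ball.mem_nhds (mem_ball_self (by positivity)), ?_⟩
    exact Calculus.uniformCauchySeqOn_iteratedFDeriv_of_uniformCauchySeqOn (fun j => (hfm j).1) one_pos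
      (fun k => ⟨PB k, fun j y _ => (hfm j).2 k y⟩) (hUC (ball x 1)) i
  obtain ⟨hs₀, hconv⟩ := contDiffOn_infty_of_uniformCauchySeqOn_iteratedFDeriv isOpen_univ
    (fun j => (hfm j).1.contDiffOn) (fun x _ => hpt x) hderC
  refine ⟨contDiffOn_univ.1 hs₀, fun k x => ?_⟩
  have ht := (hconv k).tendsto_at (mem_univ x)
  exact le_of_tendsto ht.norm (Eventually.of_forall fun j => (hfm j).2 k x)


/-! ### Vector slices from scalar components -/

section Vector

/-- The linear map `c ↦ c • e_b`. [folklore] -/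
theorem norm_smulRight_frame_le (b : Fin 3) :
    ‖((ContinuousLinearMap.id ℝ ℝ).smulRight (frame b : EuclideanSpace ℝ (Fin 3)))‖ ≤ 1 := by
  refine ContinuousLinearMap.opNorm_le_bound _ zero_le_one fun c => ?_
  rw [ContinuousLinearMap.smulRight_apply, ContinuousLinearMap.id_apply, norm_smul, frame.orthonormal.1 b, mul_one, one_mul]

/-- Composition with `c ↦ c • e_b` is compatible with differences. [folklore] -/
theorem comp_sub_frame {n : ℕ} (b : Fin 3)
    (m m' : ContinuousMultilinearMap ℝ (fun _ : Fin n => EuclideanSpace ℝ (Fin 3)) ℝ) :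
    ((ContinuousLinearMap.id ℝ ℝ).smulRight (frame b : EuclideanSpace ℝ (Fin 3))).compContinuousMultilinearMap m -
      ((ContinuousLinearMap.id ℝ ℝ).smulRight (frame b : EuclideanSpace ℝ (Fin 3))).compContinuousMultilinearMap m' =
      ((ContinuousLinearMap.id ℝ ℝ).smulRight (frame b : EuclideanSpace ℝ (Fin 3))).compContinuousMultilinearMap (m - m') := by
  ext v
  simp [sub_smul]

/-- The norm of a sum of frame components of multilinear maps. [folklore] -/
theorem norm_sum_comp_frame_le {n : ℕ}
    (m : Fin 3 → ContinuousMultilinearMap ℝ (fun _ : Fin n => EuclideanSpace ℝ (Fin 3)) ℝ) :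
    ‖∑ b, ((ContinuousLinearMap.id ℝ ℝ).smulRight (frame b : EuclideanSpace ℝ (Fin 3))).compContinuousMultilinearMap (m b)‖ ≤
      ∑ b, ‖m b‖ := by
  refine (norm_sum_le _ _).trans (Finset.sum_le_sum fun b _ => ?_)
  refine (ContinuousLinearMap.norm_compContinuousMultilinearMap_le _ _).trans ?_
  calc ‖((ContinuousLinearMap.id ℝ ℝ).smulRight (frame b : EuclideanSpace ℝ (Fin 3)))‖ * ‖m b‖ ≤ 1 * ‖m b‖ :=
        mul_le_mul_of_nonneg_right (norm_smulRight_frame_le b) (norm_nonneg _)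
    _ = ‖m b‖ := one_mul _

/-- **Iterated derivatives of a vector slice from smooth scalar components.** If
`W x = Σ_b g_b x • e_b` near `x₀` with `g_b` smooth, then
`Dⁿ W(x₀) = Σ_b (c ↦ c • e_b) ∘ Dⁿ g_b(x₀)` and `W` is smooth at `x₀`. [folklore] -/
theorem iteratedFDeriv_of_components {W : EuclideanSpace ℝ (Fin 3) → EuclideanSpace ℝ (Fin 3)}
    {g : Fin 3 → EuclideanSpace ℝ (Fin 3) → ℝ} (hg : ∀ b, ContDiff ℝ ∞ (g b)) {x₀ : EuclideanSpace ℝ (Fin 3)}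
    (hW : W =ᶠ[𝓝 x₀] fun x => ∑ b, g b x • (frame b : EuclideanSpace ℝ (Fin 3))) (n : ℕ) :
    ContDiffAt ℝ ∞ W x₀ ∧ iteratedFDeriv ℝ n W x₀ =
      ∑ b, ((ContinuousLinearMap.id ℝ ℝ).smulRight (frame b : EuclideanSpace ℝ (Fin 3))).compContinuousMultilinearMap
        (iteratedFDeriv ℝ n (g b) x₀) := by
  set L : Fin 3 → ℝ →L[ℝ] EuclideanSpace ℝ (Fin 3) := fun b =>
    (ContinuousLinearMap.id ℝ ℝ).smulRight (frame b : EuclideanSpace ℝ (Fin 3)) with hL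
  have hcomp : ∀ b, (fun x => g b x • (frame b : EuclideanSpace ℝ (Fin 3))) = L b ∘ g b := fun b => by
    funext x; simp [hL]
  have hsm : ∀ b, ContDiff ℝ ∞ (fun x => g b x • (frame b : EuclideanSpace ℝ (Fin 3))) := fun b => by
    rw [hcomp b]; exact (L b).contDiff.comp (hg b)
  have hsum : ContDiff ℝ ∞ (fun x => ∑ b, g b x • (frame b : EuclideanSpace ℝ (Fin 3))) :=
    ContDiff.sum fun b _ => hsm b
  refine ⟨hsum.contDiffAt.congr_of_eventuallyEq hW, ?_⟩
  rw [(hW.iteratedFDeriv ℝ n).eq_of_nhds]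
  rw [iteratedFDeriv_fun_sum_apply fun b _ => (hsm b).contDiffAt.of_le (by exact_mod_cast le_top)]
  refine Finset.sum_congr rfl fun b _ => ?_
  rw [hcomp b, ContinuousLinearMap.iteratedFDeriv_comp_left (L b) ((hg b).contDiffAt) (i := n) (by exact_mod_cast le_top)]

end Vector

/-! ### Hölder exponents at most one -/

/-- Lowering a Hölder exponent on a bounded set. [folklore] -/
theorem holderOnWith_of_le {X Y : Type*} [PseudoMetricSpace X] [PseudoMetricSpace Y] {C r κ : ℝ≥0}
    {f : X → Y} {s : Set X} (hf : HolderOnWith C r f s) (hκ : κ ≤ r) {D : ℝ} (hD1 : 1 ≤ D)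
    (hD : ∀ x ∈ s, ∀ y ∈ s, dist x y ≤ D) :
    HolderOnWith (C * (D ^ (r : ℝ)).toNNReal) κ f s := by
  intro x hx y hy
  have h := hf.dist_le hx hy
  have hd0 : 0 ≤ dist x y := dist_nonneg
  have hD0 : 0 < D := one_pos.trans_le hD1
  have hκr : (κ : ℝ) ≤ r := by exact_mod_cast hκ
  have hkey : dist (f x) (f y) ≤ C * D ^ (r : ℝ) * dist x y ^ (κ : ℝ) := by
    refine h.trans ?_
    set q : ℝ := dist x y / D with hq
    have hq0 : 0 ≤ q := div_nonneg hd0 hD0.le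
    have hq1 : q ≤ 1 := (div_le_one hD0).2 (hD x hx y hy)
    have hdq : dist x y = D * q := by rw [hq]; field_simp
    have h1 : dist x y ^ (r : ℝ) ≤ D ^ (r : ℝ) * dist x y ^ (κ : ℝ) := by
      calc dist x y ^ (r : ℝ) = D ^ (r : ℝ) * q ^ (r : ℝ) := by rw [hdq, Real.mul_rpow hD0.le hq0]
        _ ≤ D ^ (r : ℝ) * q ^ (κ : ℝ) :=
            mul_le_mul_of_nonneg_left (Real.rpow_le_rpow_of_exponent_ge' hq0 hq1 κ.coe_nonneg hκr) (by positivity)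
        _ = D ^ (r : ℝ) * (dist x y ^ (κ : ℝ) / D ^ (κ : ℝ)) := by rw [hq, Real.div_rpow hd0 hD0.le]
        _ ≤ D ^ (r : ℝ) * dist x y ^ (κ : ℝ) := by
            refine mul_le_mul_of_nonneg_left (div_le_self (Real.rpow_nonneg hd0 _) ?_) (by positivity)
            exact Real.one_le_rpow hD1 κ.coe_nonneg
    calc (C : ℝ) * dist x y ^ (r : ℝ) ≤ C * (D ^ (r : ℝ) * dist x y ^ (κ : ℝ)) := mul_le_mul_of_nonneg_left h1 C.coe_nonneg
      _ = C * D ^ (r : ℝ) * dist x y ^ (κ : ℝ) := by ring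
  rw [edist_dist, edist_dist, ENNReal.ofReal_rpow_of_nonneg hd0 κ.coe_nonneg, ENNReal.coe_mul, ← ENNReal.ofReal_coe_nnreal,
    show (((D ^ (r : ℝ)).toNNReal : ℝ≥0) : ℝ≥0∞) = ENNReal.ofReal (D ^ (r : ℝ)) from rfl,
    ← ENNReal.ofReal_mul C.coe_nonneg, ← ENNReal.ofReal_mul (by positivity)]
  exact ENNReal.ofReal_le_ofReal hkey


/-! ### The smooth Hölder representative, normalised -/

set_option maxHeartbeats 6400000 in
/-- **Higher regularity of bounded distributional solutions, normalised and quantitative**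
(Lemarié-Rieusset 2016, Thm. 13.1; Seregin–Šverák 2009, §2 p. 8; Serrin 1962). For `R`, `M`,
`P` there are `K C α : ℕ → ℝ → ℝ≥0` with `α n r > 0` (`0 < r < R`) such that every bounded
distributional Navier–Stokes solution `(u, p)` on `Q(0, R)` with `|u| ≤ M` a.e. and
`∫∫ |p|^{3/2} ≤ P` has a representative `V` with smooth slices at every point of `Q(0, R)`,
and for all `n`, `0 < r < R`: `w ↦ Dⁿₓ V(w.1, ·)(w.2)` is `(C n r, α n r)`-Hölder on `Q(0, r)`
and bounded there by `K n r`. [cite: LemarieRieusset2016, Thm. 13.1] -/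
theorem exists_smooth_holder_rep_norm (R M : ℝ) (P : ℝ≥0) :
    ∃ K C α : ℕ → ℝ → ℝ≥0, (∀ n : ℕ, ∀ r ∈ Ioo 0 R, 0 < α n r) ∧
      ∀ (u : ℝ → EuclideanSpace ℝ (Fin 3) → EuclideanSpace ℝ (Fin 3)) (p : ℝ → EuclideanSpace ℝ (Fin 3) → ℝ),
      IsDistributionalNSSolutionOn (parabolicCylinderOpens R (0 : ℝ × EuclideanSpace ℝ (Fin 3))) 1 0 u p →
      (∀ᵐ w ∂(volume.restrict (parabolicCylinder R (0 : ℝ × EuclideanSpace ℝ (Fin 3)))), ‖u w.1 w.2‖ ≤ M) →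
      (∫⁻ w in parabolicCylinder R (0 : ℝ × EuclideanSpace ℝ (Fin 3)), ‖p w.1 w.2‖ₑ ^ (3 / 2 : ℝ) ≤ P) →
      ∃ V : ℝ → EuclideanSpace ℝ (Fin 3) → EuclideanSpace ℝ (Fin 3),
        uncurry u =ᵐ[volume.restrict (parabolicCylinder R (0 : ℝ × EuclideanSpace ℝ (Fin 3)))] uncurry V ∧
        (∀ w ∈ parabolicCylinder R (0 : ℝ × EuclideanSpace ℝ (Fin 3)), ContDiffAt ℝ (⊤ : ℕ∞) (V w.1) w.2) ∧
        ∀ n : ℕ, ∀ r ∈ Ioo 0 R,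
          HolderOnWith (C n r) (α n r) (fun w : ℝ × EuclideanSpace ℝ (Fin 3) => iteratedFDeriv ℝ n (V w.1) w.2)
            (parabolicCylinder r (0 : ℝ × EuclideanSpace ℝ (Fin 3))) ∧
          ∀ w ∈ parabolicCylinder r (0 : ℝ × EuclideanSpace ℝ (Fin 3)), ‖iteratedFDeriv ℝ n (V w.1) w.2‖ ≤ K n r := by
  classical
  obtain ⟨K₀, κ₀, hκ₀, hrep⟩ := exists_continuous_rep (R := R) M P
  -- radii attached to `r`
  set r₁ : ℝ → ℝ := fun r => (r + R) / 2 with hr₁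
  set r₂ : ℝ → ℝ := fun r => (r + r₁ r) / 2 with hr₂
  set r₃ : ℝ → ℝ := fun r => (r + r₂ r) / 2 with hr₃
  set ρ' : ℝ → ℝ := fun r => (r₂ r + r₁ r) / 2 with hρ'
  have hrad : ∀ r ∈ Ioo 0 R, 0 < r ∧ r < r₃ r ∧ r₃ r < r₂ r ∧ r₂ r < ρ' r ∧ ρ' r < r₁ r ∧ r₁ r < R := by
    intro r hr
    simp only [hr₁, hr₂, hr₃, hρ']
    refine ⟨hr.1, by linarith [hr.2], by linarith [hr.2], by linarith [hr.2], by linarith [hr.2], by linarith [hr.2]⟩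
  -- the constants attached to `r`: slices and cut-offs
  have hcon : ∀ r : ℝ, ∃ (Ks : ℕ → ℝ≥0) (χ : EuclideanSpace ℝ (Fin 3) → ℝ) (Cχ : ℕ → ℝ), r ∈ Ioo 0 R →
      (ContDiff ℝ ∞ χ ∧ (∀ x ∈ ball (0 : EuclideanSpace ℝ (Fin 3)) (r₃ r), χ x = 1) ∧
        tsupport χ ⊆ ball (0 : EuclideanSpace ℝ (Fin 3)) (r₂ r) ∧ (∀ x, |χ x| ≤ 1) ∧
        (∀ (k : ℕ) (x : EuclideanSpace ℝ (Fin 3)), ‖iteratedFDeriv ℝ k χ x‖ ≤ Cχ k) ∧ (∀ k, 0 ≤ Cχ k)) ∧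
      ∀ (u : ℝ → EuclideanSpace ℝ (Fin 3) → EuclideanSpace ℝ (Fin 3)) (p : ℝ → EuclideanSpace ℝ (Fin 3) → ℝ),
        IsDistributionalNSSolutionOn (parabolicCylinderOpens R (0 : ℝ × EuclideanSpace ℝ (Fin 3))) 1 0 u p →
        (∀ᵐ w ∂(volume.restrict (parabolicCylinder R (0 : ℝ × EuclideanSpace ℝ (Fin 3)))), ‖u w.1 w.2‖ ≤ M) →
        (∫⁻ w in parabolicCylinder R (0 : ℝ × EuclideanSpace ℝ (Fin 3)), ‖p w.1 w.2‖ₑ ^ (3 / 2 : ℝ) ≤ P) →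
        ∀ b : Fin 3, ∀ᵐ t ∂(volume.restrict (Ioo (-(r₂ r) ^ 2) 0)), ∃ v : EuclideanSpace ℝ (Fin 3) → ℝ,
          (fun x => u t x b) =ᵐ[volume.restrict (ball (0 : EuclideanSpace ℝ (Fin 3)) (r₂ r))] v ∧
          ContDiffOn ℝ ∞ v (ball (0 : EuclideanSpace ℝ (Fin 3)) (r₂ r)) ∧
          (∀ k : ℕ, ∀ x ∈ ball (0 : EuclideanSpace ℝ (Fin 3)) (r₂ r), ‖iteratedFDeriv ℝ k v x‖ ≤ 3 ^ k * Ks k) := by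
    intro r
    by_cases hr : r ∈ Ioo 0 R
    · obtain ⟨h0, h3, h32, h2ρ, hρ1, h1R⟩ := hrad r hr
      have h10 : 0 < r₁ r := by linarith
      obtain ⟨Ks, hKs⟩ := ae_smooth_slices (R := R) (r₀ := r₁ r) (L' := (r₂ r) ^ 2) (ρ' := ρ' r) (r' := r₂ r)
        h10 h1R (by positivity) (by nlinarith) (by linarith) hρ1 h2ρ M P
      obtain ⟨χ, Cχ, hχ, hχ1, hχs, hχle, hCχ⟩ := exists_cutoff (r₃ := r₃ r) (ρ := r₂ r) (by linarith) h32
      refine ⟨Ks, χ, fun k => max (Cχ k) 0, fun _ => ⟨⟨hχ, hχ1, hχs, hχle, fun k x => (hCχ k x).trans (le_max_left _ _),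
        fun k => le_max_right _ _⟩, fun u p hsol hbd hP b => ?_⟩⟩
      exact (hKs u p hsol hbd hP b).mono fun t ⟨v, hv1, hv2, hv3, _⟩ => ⟨v, hv1, hv2, hv3⟩
    · exact ⟨fun _ => 0, fun _ => 0, fun _ => 0, fun h => absurd h hr⟩
  choose Ks χ Cχ hcon using hcon
  -- derived constants
  set PB : ℝ → ℕ → ℝ := fun r k => ∑ i ∈ Finset.range (k + 1), (k.choose i : ℝ) * Cχ r i * (3 ^ (k - i) * Ks r (k - i)) with hPB
  set cL : ℝ → ℕ → ℝ := fun r k => Nat.rec 1 (fun k c => 2 * c + 2 * PB r (k + 2)) k with hcL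
  have hPB0' : ∀ r, r ∈ Ioo 0 R → ∀ k, 0 ≤ PB r k := fun r hr k =>
    Finset.sum_nonneg fun i _ => mul_nonneg (mul_nonneg (Nat.cast_nonneg _) ((hcon r hr).1.2.2.2.2.2 i)) (by positivity)
  have hcL0 : ∀ r, r ∈ Ioo 0 R → ∀ k, 0 ≤ cL r k := by
    intro r hr k
    simp only [hcL]
    induction k with
    | zero => exact zero_le_one
    | succ k ih => exact add_nonneg (mul_nonneg two_pos.le ih) (mul_nonneg two_pos.le (hPB0' r hr _))
  set D : ℝ → ℝ := fun r => (r₁ r) ^ 2 + 2 * r₁ r + 1 with hD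
  set κ₁ : ℝ → ℝ≥0 := fun r => min (κ₀ (r₁ r)) 1 with hκ₁
  set K₁ : ℝ → ℝ≥0 := fun r => K₀ (r₁ r) * ((D r) ^ (κ₀ (r₁ r) : ℝ)).toNNReal with hK₁
  -- the outputs
  set Kf : ℕ → ℝ → ℝ≥0 := fun n r => (3 * PB r n).toNNReal with hKf
  set αf : ℕ → ℝ → ℝ≥0 := fun n r => κ₁ r * ((1 / 2 : ℝ≥0) ^ n) with hαf
  set TC : ℕ → ℝ → ℝ := fun n r => 3 * ((cL r n + 2 * PB r n) * (max (K₁ r : ℝ) 1) ^ ((1 / 2 : ℝ) ^ n)) with hTC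
  set Cf : ℕ → ℝ → ℝ≥0 := fun n r => (TC n r + 3 * PB r (n + 1) * (D r) ^ (1 : ℝ)).toNNReal with hCf
  refine ⟨Kf, Cf, αf, fun n r hr => ?_, ?_⟩
  · simp only [hαf, hκ₁]
    obtain ⟨h0, h1, h2, h3, h4, h5⟩ := hrad r hr
    exact mul_pos (lt_min (hκ₀ (r₁ r) ⟨by linarith, h5⟩) one_pos) (pow_pos (by norm_num) n)
  intro u p hsol hbd hP
  obtain ⟨V, hVc, hVae, hVsup, hVH⟩ := hrep u p hsol hbd hP
  -- facts for a fixed `r`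
  have hmain : ∀ r ∈ Ioo 0 R,
      (∀ t ∈ Ioo (-(r₂ r) ^ 2) 0, ∀ b : Fin 3, ContDiff ℝ ∞ (fun x => χ r x * V (t, x) b) ∧
        ∀ (k : ℕ) (x : EuclideanSpace ℝ (Fin 3)), ‖iteratedFDeriv ℝ k (fun x => χ r x * V (t, x) b) x‖ ≤ PB r k) ∧
      HolderOnWith (K₁ r) (κ₁ r) V (cyl ((r₁ r) ^ 2) (r₁ r)) := by
    intro r hr
    obtain ⟨h0, h3, h32, h2ρ, hρ1, h1R⟩ := hrad r hr
    have h10 : 0 < r₁ r := by linarith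
    obtain ⟨⟨hχ, hχ1, hχs, hχle, hCχ, hCχ0⟩, hsl⟩ := hcon r hr
    have hVH₁ := hVH (r₁ r) ⟨h10, h1R⟩
    have hVc₁ : ContinuousOn V (cyl ((r₁ r) ^ 2) (r₁ r)) := hVc.mono (cyl_mono (by nlinarith) h1R.le)
    -- good times: `V(t, ·) = u(t, ·)` a.e. and the smooth slices of `u`
    have hgood : ∀ᵐ t ∂(volume.restrict (Ioo (-(r₂ r) ^ 2) 0)), ∀ b : Fin 3, ∃ v : EuclideanSpace ℝ (Fin 3) → ℝ,
        (fun x => V (t, x) b) =ᵐ[volume.restrict (ball (0 : EuclideanSpace ℝ (Fin 3)) (r₂ r))] v ∧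
        ContDiffOn ℝ ∞ v (ball (0 : EuclideanSpace ℝ (Fin 3)) (r₂ r)) ∧
        ∀ k : ℕ, ∀ x ∈ ball (0 : EuclideanSpace ℝ (Fin 3)) (r₂ r), ‖iteratedFDeriv ℝ k v x‖ ≤ 3 ^ k * Ks r k := by
      have hsub : cyl ((r₂ r) ^ 2) (r₂ r) ⊆ cyl (R ^ 2) R := cyl_mono (by nlinarith) (by linarith)
      have hVu : ∀ᵐ q ∂(volume.restrict (cyl ((r₂ r) ^ 2) (r₂ r))), uncurry u q = V q :=
        ae_restrict_of_ae_restrict_of_subset hsub hVae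
      have hVu' := SerrinBoundedHolder.ae_ae_of_ae_restrict_prod hVu
      have hsl' : ∀ᵐ t ∂(volume.restrict (Ioo (-(r₂ r) ^ 2) 0)), ∀ b : Fin 3, ∃ v : EuclideanSpace ℝ (Fin 3) → ℝ,
          (fun x => u t x b) =ᵐ[volume.restrict (ball (0 : EuclideanSpace ℝ (Fin 3)) (r₂ r))] v ∧
          ContDiffOn ℝ ∞ v (ball (0 : EuclideanSpace ℝ (Fin 3)) (r₂ r)) ∧
          ∀ k : ℕ, ∀ x ∈ ball (0 : EuclideanSpace ℝ (Fin 3)) (r₂ r), ‖iteratedFDeriv ℝ k v x‖ ≤ 3 ^ k * Ks r k :=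
        ae_all_iff.2 fun b => hsl u p hsol hbd hP b
      filter_upwards [hVu', hsl'] with t ht hst b
      obtain ⟨v, hv, hvs, hvb⟩ := hst b
      refine ⟨v, ?_, hvs, hvb⟩
      have h1 : (fun x => V (t, x) b) =ᵐ[volume.restrict (ball (0 : EuclideanSpace ℝ (Fin 3)) (r₂ r))] fun x => u t x b := by
        filter_upwards [ht] with x hx
        show V (t, x) b = u t x b
        rw [← hx]; rfl
      exact h1.trans hv
    refine ⟨smooth_cutoff_slices (r₁ := r₁ r) (r₂ := r₂ r) (by linarith) (by linarith) hVc₁ (hκ₀ (r₁ r) ⟨h10, h1R⟩)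
      hVH₁ hgood hχ hχs hχle hCχ hCχ0, ?_⟩
    -- lowering the exponent
    have hD1 : 1 ≤ D r := by simp only [hD]; nlinarith
    have hdiam : ∀ x ∈ cyl ((r₁ r) ^ 2) (r₁ r), ∀ y ∈ cyl ((r₁ r) ^ 2) (r₁ r), dist x y ≤ D r := by
      intro x hx y hy
      obtain ⟨hxs, hxb⟩ := mem_prod.1 hx
      obtain ⟨hys, hyb⟩ := mem_prod.1 hy
      rw [mem_ball, dist_zero_right] at hxb hyb
      rw [Prod.dist_eq]
      refine max_le ?_ ?_
      · rw [Real.dist_eq, abs_le]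
        constructor <;> nlinarith [hxs.1, hxs.2, hys.1, hys.2]
      · calc dist x.2 y.2 ≤ ‖x.2‖ + ‖y.2‖ := dist_le_norm_add_norm _ _
          _ ≤ D r := by simp only [hD]; nlinarith
    have h := holderOnWith_of_le hVH₁ (κ := κ₁ r) (min_le_left _ _) hD1 hdiam
    exact h
  refine ⟨curry V, ?_, ?_, ?_⟩
  · rw [parabolicCylinder_zero_eq]
    have : uncurry (curry V) = V := uncurry_curry V
    rw [this]; exact hVae
  · -- smooth slices everywhere
    intro w hw
    rw [parabolicCylinder_zero_eq] at hw
    obtain ⟨r, hr0, hrR, hwr⟩ := exists_mem_cyl_of_mem_cyl hw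
    obtain ⟨h0, h3, h32, h2ρ, hρ1, h1R⟩ := hrad r ⟨hr0, hrR⟩
    obtain ⟨hsm, -⟩ := hmain r ⟨hr0, hrR⟩
    obtain ⟨⟨hχ, hχ1, hχs, hχle, hCχ, hCχ0⟩, -⟩ := hcon r ⟨hr0, hrR⟩
    obtain ⟨hws, hwy⟩ := mem_prod.1 hwr
    have hwt : w.1 ∈ Ioo (-(r₂ r) ^ 2) 0 := ⟨by nlinarith [hws.1], hws.2⟩
    have hW : (curry V w.1) =ᶠ[𝓝 w.2] fun x => ∑ b, (χ r x * V (w.1, x) b) • (frame b : EuclideanSpace ℝ (Fin 3)) := by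
      have hball : ball (0 : EuclideanSpace ℝ (Fin 3)) (r₃ r) ∈ 𝓝 w.2 :=
        isOpen_ball.mem_nhds (ball_subset_ball h3.le hwy)
      filter_upwards [hball] with x hx
      rw [curry_apply]
      conv_lhs => rw [← (EuclideanSpace.basisFun (Fin 3) ℝ).sum_repr' (V (w.1, x))]
      refine Finset.sum_congr rfl fun b _ => ?_
      rw [hχ1 x hx, one_mul, real_inner_comm, EuclideanSpace.inner_basisFun_real]
    exact (iteratedFDeriv_of_components (fun b => (hsm w.1 hwt b).1) hW 0).1
  · -- Hölder continuity and bounds of the derivatives on `Q(0, r)`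
    intro n r hr
    obtain ⟨h0, h3, h32, h2ρ, hρ1, h1R⟩ := hrad r hr
    obtain ⟨hsm, hVH₁⟩ := hmain r hr
    obtain ⟨⟨hχ, hχ1, hχs, hχle, hCχ, hCχ0⟩, -⟩ := hcon r hr
    set g : ℝ → Fin 3 → EuclideanSpace ℝ (Fin 3) → ℝ := fun t b x => χ r x * V (t, x) b with hg
    -- the representation of the derivatives on `Q(0, r)`
    have hrepD : ∀ w ∈ cyl (r ^ 2) r, iteratedFDeriv ℝ n (curry V w.1) w.2 =
        ∑ b, ((ContinuousLinearMap.id ℝ ℝ).smulRight (frame b : EuclideanSpace ℝ (Fin 3))).compContinuousMultilinearMap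
          (iteratedFDeriv ℝ n (g w.1 b) w.2) := by
      intro w hw
      obtain ⟨hws, hwy⟩ := mem_prod.1 hw
      have hwt : w.1 ∈ Ioo (-(r₂ r) ^ 2) 0 := ⟨by nlinarith [hws.1], hws.2⟩
      have hW : (curry V w.1) =ᶠ[𝓝 w.2] fun x => ∑ b, (g w.1 b x) • (frame b : EuclideanSpace ℝ (Fin 3)) := by
        have hball : ball (0 : EuclideanSpace ℝ (Fin 3)) (r₃ r) ∈ 𝓝 w.2 :=
          isOpen_ball.mem_nhds (ball_subset_ball h3.le hwy)
        filter_upwards [hball] with x hx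
        rw [curry_apply]
        conv_lhs => rw [← (EuclideanSpace.basisFun (Fin 3) ℝ).sum_repr' (V (w.1, x))]
        refine Finset.sum_congr rfl fun b _ => ?_
        simp only [hg]
        rw [hχ1 x hx, one_mul, real_inner_comm, EuclideanSpace.inner_basisFun_real]
      exact (iteratedFDeriv_of_components (fun b => (hsm w.1 hwt b).1) hW n).2
    have hPB0 : ∀ k, 0 ≤ PB r k := fun k =>
      Finset.sum_nonneg fun i _ => mul_nonneg (mul_nonneg (Nat.cast_nonneg _) (hCχ0 i)) (by positivity)
    -- time modulus of the derivatives of the components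
    have htime : ∀ t ∈ Ioo (-(r₂ r) ^ 2) 0, ∀ s ∈ Ioo (-(r₂ r) ^ 2) 0, ∀ (b : Fin 3) (y : EuclideanSpace ℝ (Fin 3)),
        ‖iteratedFDeriv ℝ n (g t b) y - iteratedFDeriv ℝ n (g s b) y‖ ≤
          (cL r n + 2 * PB r n) * (max (K₁ r : ℝ) 1) ^ ((1 / 2 : ℝ) ^ n) * |t - s| ^ ((κ₁ r : ℝ) * (1 / 2 : ℝ) ^ n) := by
      intro t ht s hs b y
      have hgt := hsm t ht b
      have hgs := hsm s hs b
      set h : EuclideanSpace ℝ (Fin 3) → ℝ := fun x => g t b x - g s b x with hh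
      have hhs : ContDiff ℝ ∞ h := hgt.1.sub hgs.1
      have hhD : ∀ (k : ℕ) (x : EuclideanSpace ℝ (Fin 3)), iteratedFDeriv ℝ k h x =
          iteratedFDeriv ℝ k (g t b) x - iteratedFDeriv ℝ k (g s b) x := fun k x => by
        simp only [hh]
        exact iteratedFDeriv_sub_apply (hgt.1.contDiffAt.of_le (by exact_mod_cast le_top))
          (hgs.1.contDiffAt.of_le (by exact_mod_cast le_top))
      have hhB : ∀ (k : ℕ) (x : EuclideanSpace ℝ (Fin 3)), ‖iteratedFDeriv ℝ k h x‖ ≤ 2 * PB r k := fun k x => by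
        rw [hhD]; exact (norm_sub_le _ _).trans (by linarith [hgt.2 k x, hgs.2 k x])
      -- the modulus of `h` itself
      have hsubc : Ioo (-(r₂ r) ^ 2) 0 ×ˢ ball (0 : EuclideanSpace ℝ (Fin 3)) (r₂ r) ⊆ cyl ((r₁ r) ^ 2) (r₁ r) :=
        Set.prod_mono (Ioo_subset_Ioo (by nlinarith) le_rfl) (ball_subset_ball (by linarith))
      set ε : ℝ := (K₁ r : ℝ) * |t - s| ^ (κ₁ r : ℝ) with hε
      have hε0 : 0 ≤ ε := by positivity
      have hh0 : ∀ x, ‖h x‖ ≤ ε := by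
        intro x
        simp only [hh, hg]
        by_cases hx : x ∈ ball (0 : EuclideanSpace ℝ (Fin 3)) (r₂ r)
        · have h1 := hVH₁.dist_le (hsubc (mk_mem_prod ht hx)) (hsubc (mk_mem_prod hs hx))
          have hd : dist (t, x) (s, x) = |t - s| := by
            rw [Prod.dist_eq, dist_self, Real.dist_eq]; exact max_eq_left (abs_nonneg _)
          rw [dist_eq_norm, hd] at h1
          rw [← mul_sub, norm_mul, Real.norm_eq_abs]
          have hcomp : ‖V (t, x) b - V (s, x) b‖ ≤ ‖V (t, x) - V (s, x)‖ := by
            have hc := PiLp.norm_apply_le (p := 2) (V (t, x) - V (s, x)) b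
            simpa using hc
          calc |χ r x| * ‖V (t, x) b - V (s, x) b‖ ≤ 1 * ‖V (t, x) - V (s, x)‖ :=
                mul_le_mul (hχle x) hcomp (norm_nonneg _) zero_le_one
            _ ≤ ε := by rw [one_mul, hε]; exact h1
        · have hx0 : χ r x = 0 := image_eq_zero_of_notMem_tsupport fun h' => hx (hχs h')
          simp only [hx0, zero_mul, sub_self, norm_zero]
          exact hε0
      have hfin : ‖iteratedFDeriv ℝ n h y‖ ≤ (cL r n + 2 * PB r n) * (max (K₁ r : ℝ) 1) ^ ((1 / 2 : ℝ) ^ n) *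
          |t - s| ^ ((κ₁ r : ℝ) * (1 / 2 : ℝ) ^ n) := by
        have hcL0n : 0 ≤ cL r n := hcL0 r hr n
        have hpowsplit : ε ^ ((1 / 2 : ℝ) ^ n) = (K₁ r : ℝ) ^ ((1 / 2 : ℝ) ^ n) * |t - s| ^ ((κ₁ r : ℝ) * (1 / 2 : ℝ) ^ n) := by
          rw [hε, Real.mul_rpow (K₁ r).coe_nonneg (Real.rpow_nonneg (abs_nonneg _) _), ← Real.rpow_mul (abs_nonneg _)]
        have hKmax : (K₁ r : ℝ) ^ ((1 / 2 : ℝ) ^ n) ≤ (max (K₁ r : ℝ) 1) ^ ((1 / 2 : ℝ) ^ n) :=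
          Real.rpow_le_rpow (K₁ r).coe_nonneg (le_max_left _ _) (by positivity)
        by_cases hε1 : ε ≤ 1
        · have hL := norm_iteratedFDeriv_le_of_small hhs (B := fun k => 2 * PB r k) (fun k => mul_nonneg two_pos.le (hPB0 k))
            hhB hε0 hε1 hh0 n y
          refine hL.trans ?_
          rw [hpowsplit]
          have e : (Nat.rec 1 (fun k c => 2 * c + 2 * PB r (k + 2)) n : ℝ) = cL r n := rfl
          rw [e]
          calc cL r n * ((K₁ r : ℝ) ^ ((1 / 2 : ℝ) ^ n) * |t - s| ^ ((κ₁ r : ℝ) * (1 / 2 : ℝ) ^ n))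
              ≤ (cL r n + 2 * PB r n) * ((max (K₁ r : ℝ) 1) ^ ((1 / 2 : ℝ) ^ n) * |t - s| ^ ((κ₁ r : ℝ) * (1 / 2 : ℝ) ^ n)) := by
                refine mul_le_mul (by linarith [hPB0 n]) (mul_le_mul_of_nonneg_right hKmax (by positivity)) (by positivity)
                  (add_nonneg hcL0n (mul_nonneg two_pos.le (hPB0 n)))
            _ = _ := by ring
        · rw [not_le] at hε1
          have h1 : 1 ≤ ε ^ ((1 / 2 : ℝ) ^ n) := Real.one_le_rpow hε1.le (by positivity)
          calc ‖iteratedFDeriv ℝ n h y‖ ≤ 2 * PB r n := hhB n y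
            _ ≤ (cL r n + 2 * PB r n) * ε ^ ((1 / 2 : ℝ) ^ n) := by
                calc 2 * PB r n = 2 * PB r n * 1 := (mul_one _).symm
                  _ ≤ (cL r n + 2 * PB r n) * ε ^ ((1 / 2 : ℝ) ^ n) :=
                      mul_le_mul (by linarith) h1 zero_le_one (add_nonneg hcL0n (mul_nonneg two_pos.le (hPB0 n)))
            _ ≤ _ := by
                rw [hpowsplit]
                calc (cL r n + 2 * PB r n) * ((K₁ r : ℝ) ^ ((1 / 2 : ℝ) ^ n) * |t - s| ^ ((κ₁ r : ℝ) * (1 / 2 : ℝ) ^ n))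
                    ≤ (cL r n + 2 * PB r n) * ((max (K₁ r : ℝ) 1) ^ ((1 / 2 : ℝ) ^ n) * |t - s| ^ ((κ₁ r : ℝ) * (1 / 2 : ℝ) ^ n)) :=
                      mul_le_mul_of_nonneg_left (mul_le_mul_of_nonneg_right hKmax (by positivity))
                        (add_nonneg hcL0n (mul_nonneg two_pos.le (hPB0 n)))
                  _ = _ := by ring
      rw [← hhD n y]
      exact hfin
    -- space modulus
    have hspace : ∀ t ∈ Ioo (-(r₂ r) ^ 2) 0, ∀ (b : Fin 3) (y y' : EuclideanSpace ℝ (Fin 3)),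
        ‖iteratedFDeriv ℝ n (g t b) y - iteratedFDeriv ℝ n (g t b) y'‖ ≤ PB r (n + 1) * ‖y - y'‖ :=
      fun t ht b y y' => Calculus.norm_iteratedFDeriv_sub_le_of_bound (hsm t ht b).1 (fun z => (hsm t ht b).2 (n + 1) z) y y'
    refine ⟨?_, fun w hw => ?_⟩
    · -- Hölder
      refine holderOnWith_of_norm_sub_le fun w hw w' hw' => ?_
      rw [parabolicCylinder_zero_eq] at hw hw'
      obtain ⟨hws, hwy⟩ := mem_prod.1 hw
      obtain ⟨hw's, hw'y⟩ := mem_prod.1 hw'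
      have hwt : w.1 ∈ Ioo (-(r₂ r) ^ 2) 0 := ⟨by nlinarith [hws.1], hws.2⟩
      have hw't : w'.1 ∈ Ioo (-(r₂ r) ^ 2) 0 := ⟨by nlinarith [hw's.1], hw's.2⟩
      rw [hrepD w hw, hrepD w' hw', ← Finset.sum_sub_distrib]
      simp_rw [comp_sub_frame]
      refine (norm_sum_comp_frame_le _).trans ?_
      -- each component
      set d : ℝ := dist w w' with hd
      have hd0 : 0 ≤ d := dist_nonneg
      have hdt : |w.1 - w'.1| ≤ d := by rw [hd, Prod.dist_eq, Real.dist_eq]; exact le_max_left _ _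
      have hdy : ‖w.2 - w'.2‖ ≤ d := by rw [hd, Prod.dist_eq, ← dist_eq_norm]; exact le_max_right _ _
      have hdD : d ≤ D r := by
        rw [hd, Prod.dist_eq]
        rw [mem_ball, dist_zero_right] at hwy hw'y
        refine max_le ?_ ?_
        · rw [Real.dist_eq, abs_le]; constructor <;> nlinarith [hws.1, hws.2, hw's.1, hw's.2]
        · calc dist w.2 w'.2 ≤ ‖w.2‖ + ‖w'.2‖ := dist_le_norm_add_norm _ _
            _ ≤ D r := by simp only [hD]; nlinarith
      set a : ℝ := (κ₁ r : ℝ) * (1 / 2 : ℝ) ^ n with ha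
      have ha0 : 0 ≤ a := by positivity
      have ha1 : a ≤ 1 := by
        have h1 : (κ₁ r : ℝ) ≤ 1 := by simp only [hκ₁]; exact_mod_cast min_le_right _ _
        have h2 : (1 / 2 : ℝ) ^ n ≤ 1 := pow_le_one₀ (by norm_num) (by norm_num)
        calc a ≤ 1 * 1 := mul_le_mul h1 h2 (by positivity) zero_le_one
          _ = 1 := one_mul _
      have hαcoe : ((αf n r : ℝ≥0) : ℝ) = a := by simp only [hαf, ha]; push_cast; ring
      have hD1 : 1 ≤ D r := by simp only [hD]; nlinarith
      -- `‖y - y'‖ ≤ d ≤ D^{1-a} d^a ≤ D d^a`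
      have hdpow : d ≤ D r ^ (1 : ℝ) * d ^ a := by
        rcases hd0.eq_or_lt with h | h
        · rw [← h]; exact mul_nonneg (Real.rpow_nonneg (by linarith) _) (Real.rpow_nonneg le_rfl _)
        · have hsplit : d = d ^ (1 - a) * d ^ a := by
            rw [← Real.rpow_add h]; norm_num
          calc d = d ^ (1 - a) * d ^ a := hsplit
            _ ≤ D r ^ (1 : ℝ) * d ^ a := by
                refine mul_le_mul_of_nonneg_right ?_ (Real.rpow_nonneg hd0 _)
                calc d ^ (1 - a) ≤ D r ^ (1 - a) := Real.rpow_le_rpow hd0 hdD (by linarith)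
                  _ ≤ D r ^ (1 : ℝ) := Real.rpow_le_rpow_of_exponent_le hD1 (by linarith)
      have htpow : |w.1 - w'.1| ^ a ≤ d ^ a := Real.rpow_le_rpow (abs_nonneg _) hdt ha0
      set Tc : ℝ := (cL r n + 2 * PB r n) * (max (K₁ r : ℝ) 1) ^ ((1 / 2 : ℝ) ^ n) with hTc
      have hTc0 : 0 ≤ Tc :=
        mul_nonneg (add_nonneg (hcL0 r hr n) (mul_nonneg two_pos.le (hPB0 n))) (Real.rpow_nonneg (le_max_of_le_right zero_le_one) _)
      have hcompb : ∀ b, ‖iteratedFDeriv ℝ n (g w.1 b) w.2 - iteratedFDeriv ℝ n (g w'.1 b) w'.2‖ ≤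
          (Tc + PB r (n + 1) * D r ^ (1 : ℝ)) * d ^ a := by
        intro b
        calc ‖iteratedFDeriv ℝ n (g w.1 b) w.2 - iteratedFDeriv ℝ n (g w'.1 b) w'.2‖
            ≤ ‖iteratedFDeriv ℝ n (g w.1 b) w.2 - iteratedFDeriv ℝ n (g w'.1 b) w.2‖ +
              ‖iteratedFDeriv ℝ n (g w'.1 b) w.2 - iteratedFDeriv ℝ n (g w'.1 b) w'.2‖ := norm_sub_le_norm_sub_add_norm_sub _ _ _
          _ ≤ Tc * |w.1 - w'.1| ^ a + PB r (n + 1) * ‖w.2 - w'.2‖ :=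
              add_le_add (htime w.1 hwt w'.1 hw't b w.2) (hspace w'.1 hw't b w.2 w'.2)
          _ ≤ Tc * d ^ a + PB r (n + 1) * (D r ^ (1 : ℝ) * d ^ a) :=
              add_le_add (mul_le_mul_of_nonneg_left htpow hTc0) (mul_le_mul_of_nonneg_left (hdy.trans hdpow) (hPB0 _))
          _ = (Tc + PB r (n + 1) * D r ^ (1 : ℝ)) * d ^ a := by ring
      have hTCeq : TC n r = 3 * Tc := rfl
      have hCfcoe : ((Cf n r : ℝ≥0) : ℝ) = 3 * (Tc + PB r (n + 1) * D r ^ (1 : ℝ)) := by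
        have hnn : 0 ≤ TC n r + 3 * PB r (n + 1) * D r ^ (1 : ℝ) := by
          rw [hTCeq]
          exact add_nonneg (mul_nonneg (by norm_num) hTc0)
            (mul_nonneg (mul_nonneg (by norm_num) (hPB0 _)) (Real.rpow_nonneg (by linarith) _))
        simp only [hCf]
        rw [Real.coe_toNNReal _ hnn, hTCeq]
        ring
      rw [hαcoe, hCfcoe]
      calc ∑ b, ‖iteratedFDeriv ℝ n (g w.1 b) w.2 - iteratedFDeriv ℝ n (g w'.1 b) w'.2‖
          ≤ ∑ _b : Fin 3, (Tc + PB r (n + 1) * D r ^ (1 : ℝ)) * d ^ a := Finset.sum_le_sum fun b _ => hcompb b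
        _ = 3 * (Tc + PB r (n + 1) * D r ^ (1 : ℝ)) * dist w w' ^ a := by
            rw [Finset.sum_const, Finset.card_univ, Fintype.card_fin, hd]; ring
    · -- bounds
      rw [parabolicCylinder_zero_eq] at hw
      obtain ⟨hws, hwy⟩ := mem_prod.1 hw
      have hwt : w.1 ∈ Ioo (-(r₂ r) ^ 2) 0 := ⟨by nlinarith [hws.1], hws.2⟩
      rw [hrepD w hw]
      refine (norm_sum_comp_frame_le _).trans ?_
      have hKfcoe : ((Kf n r : ℝ≥0) : ℝ) = 3 * PB r n := by
        simp only [hKf]; rw [Real.coe_toNNReal _ (by linarith [hPB0 n])]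
      rw [hKfcoe]
      calc ∑ b, ‖iteratedFDeriv ℝ n (g w.1 b) w.2‖ ≤ ∑ _b : Fin 3, PB r n :=
            Finset.sum_le_sum fun b _ => (hsm w.1 hwt b).2 n w.2
        _ = 3 * PB r n := by rw [Finset.sum_const, Finset.card_univ, Fintype.card_fin]; ring

end NSBootstrap

end Literature.Analysis.FluidPDE

end
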